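import Summits.BirchSwinnertonDyer.BirchSwinnertonDyer.Theorems.ErratumRoadFiveOpenInputIMCRest3FromPrint
import Summits.BirchSwinnertonDyer.BirchSwinnertonDyer.Theorems.Rank1ResidualIntModelReduction
import Summits.BirchSwinnertonDyer.Rank1Residual.X5.TwoAdicInstancesToolkit
import Literature.NumberTheory.EllipticCurves.Rank1Residual.X9NoEntry
import Literature.NumberTheory.EllipticCurves.BSDRootNumberSmallConductorProofs
import HarnessLib

/-!
# Route `ErratumRoadFive` (rung K2, `p ≥ 5`), crux `OpenInputIMC` (item stmt-BirchSwinnertonDyer-19061):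
# a BC5 RUNG — route p2's open input `P2OpenInputOnTreeAt E 5` at the explicit erratum-claimed (ram)
# pair `E = 65a1`, `p = 5`, modulo the ONE preprint input H3♭ AT THAT PAIR and PUBLISHED named facts
# (cell `bsd-stepL`, seat `bsd-stepL-imc-p1` g4; `--supports stmt-BirchSwinnertonDyer-19061 --as helper`)

HONEST FRAMING (cell `bsd-stepL`, run/shared/lean/pub/bsd-stepL/, HUMAN RULINGS D-0059 ∕ D-0074):
THEOREMS ONLY (no definition, no named fact, no `sorry`, no `native_decide`; axioms standard); nothing
is booked; BSD is NOT proved by any of this; the rung is ONE curve and closes no item and no census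
class. PARTITION (D-0054): X11b@p≥5 (B9 ∕ N8) × the pair `(65a1, 5)` (book230 class `65a`, `r = 1`)
× `p = 5 ∥ N = 65` — types-the-object-of (an instance of crux 2 = item 19061 on the erratum sub-locus
«odd NON-split `E[p]`-ramified multiplicative `q ≠ p` ∧ `E(ℚ_p)[p] = 0`», cw 1 451 905 of the 2 155 109
(ram) pairs `N < 5·10⁵`, imc-p1 g3 REDUCTION-19061); closes: none.

WHY (judge J, K2 j-addendum-1 800ae07c 2026-08-26T10:27Z, ask (2); planner g25 dispatch 10:37:32Z
«K2-(2) [BC5 witness] → imc-p1 g4 ∕ bdp g12»): the tribunal's T3 target for the erratum road is ONE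
explicit X11b pair at which the crux's content is exhibited from the preprint input and print alone,
with every numerical side condition certified IN THE KERNEL — the planner then files the fit-only
edit `tribunal_fit.witness := <this decl>`.

THE PAIR. `E = 65a1`: Cremona `[1, 0, 0, −1, 0]`, `y² + xy = x³ − x`, `N = 65 = 5·13`, `Δ = 65`,
`c₄ = 49`, `r_an = 1` (Cremona's table; the smallest-conductor X11b pair at `p = 5` on the erratum
sub-locus, census `census2_all_500k` row `65a1 5 65 surj 1 nonsplit 1 1 1 1 1 1 0 1 …`). KERNEL-DECIDED
here (§§1–2; `decide` ∕ `norm_num` on the literal integer model, through the tree's certificate lemmas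
`IntModel.*` of `Rank1ResidualIntModelReduction.lean`, `X5.Instances.*` of `TwoAdicInstancesToolkit.lean`,
`LocalTorsion.*` of `X11b/LocalTorsionMultiplicative.lean`, `surj_of_irr_of_ram` of `X9NoEntry.lean`):
`Δ ≠ 0`; global minimality (`gcd(Δ, c₄) = 1`); `N = 65`; `5` NON-split multiplicative (`5 ∣ Δ`,
`5 ∤ c₄`, node-tangent quadratic `49T² + 49T − 6` root-free mod `5`); `13` NON-split multiplicative
(same, mod `13`); `v₁₃(Δ_min) = 1`, so `5 ∤ v₁₃(Δ_min)`: `E[5]` ramified at `13` = the (ram) witness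
AND erratum hypothesis (iii)'s odd non-split witness; erratum hypothesis (iv) `E(ℚ₅)[5] = 0` (non-split
`5 ≥ 3`); `#Ẽ(𝔽₂) = 4`, `a₂ = −1`, `X² + X + 2` root-free mod `5` ⟹ `E[5]` irreducible (Mazur 1978
Prop. 6.3 (1)); hence `ρ̄_{E,5}` ONTO (irr ∧ ram, Serre 1972 Prop. 15) — so the open input at this
pair is NOT vacuous. NOT decided (carried by the `ClassX11b` binder INSIDE the predicate
`P2OpenInputOnTreeAt`, exactly as in the K2@3 rung `RegMult.Rung62310y1.rung_62310y1_of_GZK`):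
`r_an(65a1) = 1`.

THE RUNG (§3): `openInputOnTreeAt_65a1_5` — (VN_p) `castella2018Exceptional_bdpValueContinuity_trivialChar`
(PUBLISHED, Castella JIMJ 17 (2018) Thms. 2.10–2.11 + BDP13, p434741) + the eleven published ∕ two
cited named facts of imc-p1's reduction (`hGZ86 hGZK hWu hSk hnf hCST hFH hMaz hGZ hKo hPT hEP`, =
the conjuncts of item 19283 `PublishedInputsIMCReduction` and item 19285) + the JSW control fact
`thm331_anticyclotomicControl_mult` (PUBLISHED, p428223) + **H3♭ AT THIS PAIR**
`P2.IMCDivIntCoreFrameAtErratumData E 5` (erratum (2.4) ⇐ [FW21, Thm. 4.41] on the erratum data of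
`(65a1, 5)` — the instance at this pair of the deciding child 19270 `IMCDivAtErratumDataAll`; PREPRINT,
the ONLY non-published input) ⟹ `P2OpenInputOnTreeAt E 5`, i.e. `2·(ord₅ log_ω P − 1) ≤ ord₅ f_ac(0)`
at EVERY odd-`d_K` Manin-good classical Heegner datum of `(65a1, 5)`. One line from imc-p1 g3's
pair-level `openInputOnTreeAt_of_oddNonsplitRam_of_localTorsion_of_core_of_castella2018Exceptional`
(p437572) with `q = 13` and (iv) supplied by §2. §4: the same over the route's ITEMS by name
(`openInputOnTreeAt_65a1_5_of_items`: (VN_p) → 19270 → 19283 → 19285 → JSW fact → open input at the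
pair) and in closed form with the two instance facts installed (`openInputOnTreeAt_65a1_5_closed`).

The curve is written LITERALLY throughout (`(⟨1, 0, 0, −1, 0⟩ : WeierstrassCurve ℤ).baseChange ℚ`; no
abbreviation is declared, so that this file stays a pure-proof file — the pattern of
`ByReductionTypeAtTwoSupersingularRung5021a.lean`); statements needing `IsElliptic` ∕ `IsGloballyMinimal`
take them as instance binders, and both are THEOREMS of §1 (`isElliptic_65a1`, `isGloballyMinimal_65a1`).

References: [Castella2018Erratum] Thm. 1.1 (i)–(iv), (2.4) (pp. 1, 4); [Castella2024] arXiv:2409.01360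
Thm. 3.1; [FouquetWan2021] arXiv:2107.13726 Thm. 4.41; [Castella2018Exceptional] Thms. 2.10–2.11;
[JetchevSkinnerWan2017] Thm. 3.3.1, §3.5; [Wuthrich2014] Prop. 21; [SilvermanAEC2009] VII.1 Rem. 1.1,
VII.5 Prop. 5.1, VII.6.1; [Silverman1994] IV.10.2; [Mazur1978] Prop. 6.3 (1); [Serre1972] Prop. 15;
[Cremona1997] Table 1 (curve 65a1); [Miller2011LMS] Def. 1.1.
-/

set_option autoImplicit false
-- the Theorems namespace of this sub repeats the summit name by design (D-0017 nested layout)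
set_option linter.dupNamespace false

noncomputable section

open scoped Classical

open WeierstrassCurve IsDedekindDomain NumberField
  Literature.NumberTheory.EllipticCurves Literature.NumberTheory.EllipticCurves.ModularForms
  Literature.NumberTheory.EllipticCurves.Rank1Residual
  Literature.NumberTheory.EllipticCurves.Rank1Residual.Typed
  Literature.NumberTheory.EllipticCurves.Wuthrich2014
  Literature.NumberTheory.EllipticCurves.Castella2018
  Literature.NumberTheory.EllipticCurves.JetchevSkinnerWan2017
  Literature.NumberTheory.GaloisRepresentations Literature.NumberTheory.GaloisCohomology
  Summit.BirchSwinnertonDyer.Rank1Residual Summit.BirchSwinnertonDyer.Rank1Residual.X11b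
  Summit.BirchSwinnertonDyer.BirchSwinnertonDyer.Rank1Residual.IntModel
  Summit.BirchSwinnertonDyer.BirchSwinnertonDyer.Theses

namespace Summit.BirchSwinnertonDyer.BirchSwinnertonDyer.Theorems

/-! ## §1 The model `65a1` and its kernel-decided invariants

The curve is written LITERALLY throughout (no abbreviation is declared, so that this file stays a
pure-proof file): `M = ⟨1, 0, 0, −1, 0⟩ : WeierstrassCurve ℤ` (Cremona `65a1`, `y² + xy = x³ − x`)
and `E = M ⊗ ℚ`. -/

/-- `Δ(65a1) = 65 = 5·13`. [cite: Cremona1997, Table 1 (curve 65a1)] -/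
theorem M65a1_Δ : (⟨1, 0, 0, -1, 0⟩ : WeierstrassCurve ℤ).Δ = 65 := by decide

/-- `c₄(65a1) = 49 = 7²`. [cite: Cremona1997, Table 1 (curve 65a1)] -/
theorem M65a1_c₄ : (⟨1, 0, 0, -1, 0⟩ : WeierstrassCurve ℤ).c₄ = 49 := by decide

/-- `65a1` is an elliptic curve (`Δ = 65 ≠ 0`). [cite: SilvermanAEC2009, III.1] -/
theorem isElliptic_65a1 : ((⟨1, 0, 0, -1, 0⟩ : WeierstrassCurve ℤ).baseChange ℚ).IsElliptic := by
  rw [WeierstrassCurve.isElliptic_iff, baseChange_int_Δ, M65a1_Δ]; norm_num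

/-- Cremona's model `[1, 0, 0, −1, 0]` of `65a1` is globally minimal (`gcd(Δ, c₄) = gcd(65, 49) = 1`).
[cite: SilvermanAEC2009, VII.1 Remark 1.1] -/
theorem isGloballyMinimal_65a1 :
    ((⟨1, 0, 0, -1, 0⟩ : WeierstrassCurve ℤ).baseChange ℚ).IsGloballyMinimal :=
  X5.Instances.isGloballyMinimal_baseChange_int_of_gcd_eq_one 1 0 0 (-1) 0 (by decide)

/-- `Δ(65a1)` and `c₄(65a1)` are coprime (a semistable model). [cite: SilvermanAEC2009, VII.5 Prop. 5.1(b)] -/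
theorem M65a1_coprime :
    IsCoprime (⟨1, 0, 0, -1, 0⟩ : WeierstrassCurve ℤ).Δ (⟨1, 0, 0, -1, 0⟩ : WeierstrassCurve ℤ).c₄ := by
  rw [M65a1_Δ, M65a1_c₄, Int.isCoprime_iff_gcd_eq_one]; decide

/-- **`N(65a1) = 65 = 5·13`** (semistable: `N = rad Δ`). [cite: Silverman1994, IV.10.2 (a),(b)]
[cite: Cremona1997, Table 1 (curve 65a1)] -/
theorem conductorNorm_65a1 [((⟨1, 0, 0, -1, 0⟩ : WeierstrassCurve ℤ).baseChange ℚ).IsElliptic] :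
    ((⟨1, 0, 0, -1, 0⟩ : WeierstrassCurve ℤ).baseChange ℚ).conductorNorm ℤ = 65 := by
  refine X5.Instances.conductorNorm_baseChange_int_of_isCoprime (⟨1, 0, 0, -1, 0⟩ : WeierstrassCurve ℤ)
    M65a1_coprime (k := 1) ?_ ?_ ?_
  · exact Nat.squarefree_mul_iff.mpr ⟨by norm_num, (show Nat.Prime 5 by norm_num).prime.squarefree,
      (show Nat.Prime 13 by norm_num).prime.squarefree⟩
  · rw [M65a1_Δ]; norm_num
  · rw [M65a1_Δ]; norm_num

/-! ## §2 Local data at `5` and `13`, the (ram) witness, (iv), `E[5]` irreducible and `ρ̄_{E,5}` onto -/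

/-- `Fact (Nat.Prime 13)`, for the prime-indexed predicates at `q = 13`. -/
private theorem fact_prime_13 : Fact (Nat.Prime 13) := ⟨by norm_num⟩

/-- **Multiplicative reduction at `5`** (`5 ∣ Δ = 65`, `5 ∤ c₄ = 49`). [cite: SilvermanAEC2009, VII.5 Prop. 5.1(b)] -/
theorem mult_five_65a1 [((⟨1, 0, 0, -1, 0⟩ : WeierstrassCurve ℤ).baseChange ℚ).IsElliptic]
    [((⟨1, 0, 0, -1, 0⟩ : WeierstrassCurve ℤ).baseChange ℚ).IsGloballyMinimal] :
    Mult ((⟨1, 0, 0, -1, 0⟩ : WeierstrassCurve ℤ).baseChange ℚ) 5 :=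
  hasMultiplicativeReductionAtPrime_of_intModel (integralModelInt_baseChange_int _) 5
    (by rw [M65a1_Δ]; decide) (by rw [M65a1_c₄]; decide)

/-- **NON-split multiplicative at `5`**: the node-tangent quadratic `49T² + 49T − 6` of the model is
root-free mod `5`. [cite: SilvermanAEC2009, VII.5 Prop. 5.1(b)] -/
theorem not_split_five_65a1 [((⟨1, 0, 0, -1, 0⟩ : WeierstrassCurve ℤ).baseChange ℚ).IsElliptic]
    [((⟨1, 0, 0, -1, 0⟩ : WeierstrassCurve ℤ).baseChange ℚ).IsGloballyMinimal] :
    ¬ ((⟨1, 0, 0, -1, 0⟩ : WeierstrassCurve ℤ).baseChange ℚ).HasSplitMultiplicativeReductionAtPrime 5 :=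
  not_hasSplitMultiplicativeReductionAtPrime_of_intModel_of_noroot (integralModelInt_baseChange_int _) 5
    (by rw [M65a1_Δ]; decide) (by rw [M65a1_c₄]; decide) (by decide)

/-- **Multiplicative reduction at `13`** (`13 ∣ Δ = 65`, `13 ∤ c₄ = 49`). [cite: SilvermanAEC2009, VII.5 Prop. 5.1(b)] -/
theorem mult_thirteen_65a1 [((⟨1, 0, 0, -1, 0⟩ : WeierstrassCurve ℤ).baseChange ℚ).IsElliptic]
    [((⟨1, 0, 0, -1, 0⟩ : WeierstrassCurve ℤ).baseChange ℚ).IsGloballyMinimal] :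
    @Mult ((⟨1, 0, 0, -1, 0⟩ : WeierstrassCurve ℤ).baseChange ℚ) 13 fact_prime_13 :=
  @hasMultiplicativeReductionAtPrime_of_intModel _ _ _ _ (integralModelInt_baseChange_int _) 13
    fact_prime_13 (by rw [M65a1_Δ]; decide) (by rw [M65a1_c₄]; decide)

/-- **NON-split multiplicative at `13`**: the node-tangent quadratic `49T² + 49T − 6` is root-free
mod `13` (its discriminant `49·73 ≡ 2` is a non-residue mod `13`). [cite: SilvermanAEC2009, VII.5 Prop. 5.1(b)] -/
theorem not_split_thirteen_65a1 [((⟨1, 0, 0, -1, 0⟩ : WeierstrassCurve ℤ).baseChange ℚ).IsElliptic]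
    [((⟨1, 0, 0, -1, 0⟩ : WeierstrassCurve ℤ).baseChange ℚ).IsGloballyMinimal] :
    ¬ @WeierstrassCurve.HasSplitMultiplicativeReductionAtPrime
        ((⟨1, 0, 0, -1, 0⟩ : WeierstrassCurve ℤ).baseChange ℚ) 13 fact_prime_13 :=
  @not_hasSplitMultiplicativeReductionAtPrime_of_intModel_of_noroot _ _ _ _
    (integralModelInt_baseChange_int _) 13 fact_prime_13
    (by rw [M65a1_Δ]; decide) (by rw [M65a1_c₄]; decide) (by decide)

/-- `v₁₃(Δ_min(65a1)) = 1` — so `5 ∤ v₁₃(Δ_min)`: `E[5]` is ramified at `13` (Tate).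
[cite: SilvermanAEC2009, VII.5 Prop. 5.1(b)] -/
theorem padicValInt_thirteen_minimalDiscriminant_65a1
    [((⟨1, 0, 0, -1, 0⟩ : WeierstrassCurve ℤ).baseChange ℚ).IsGloballyMinimal] :
    padicValInt 13 ((⟨1, 0, 0, -1, 0⟩ : WeierstrassCurve ℤ).baseChange ℚ).minimalDiscriminantInt = 1 := by
  haveI := fact_prime_13
  rw [minimalDiscriminantInt_baseChange_int, M65a1_Δ]
  exact padicValInt_eq_of_dvd_of_not_dvd 13 (by decide) (by decide)

/-- `v₅(Δ_min(65a1)) = 1`. [cite: SilvermanAEC2009, VII.5 Prop. 5.1(b)] -/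
theorem padicValInt_five_minimalDiscriminant_65a1
    [((⟨1, 0, 0, -1, 0⟩ : WeierstrassCurve ℤ).baseChange ℚ).IsGloballyMinimal] :
    padicValInt 5 ((⟨1, 0, 0, -1, 0⟩ : WeierstrassCurve ℤ).baseChange ℚ).minimalDiscriminantInt = 1 := by
  rw [minimalDiscriminantInt_baseChange_int, M65a1_Δ]
  exact padicValInt_eq_of_dvd_of_not_dvd 5 (by decide) (by decide)

/-- **The (ram) witness at `p = 5`**: `13 ≠ 5` is multiplicative with `5 ∤ v₁₃(Δ_min) = 1`
(`Rank1Residual.Ram`). [cite: SkinnerUrban2014, Thm. 2 (p. 3), second bullet] -/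
theorem ram_five_65a1 [((⟨1, 0, 0, -1, 0⟩ : WeierstrassCurve ℤ).baseChange ℚ).IsElliptic]
    [((⟨1, 0, 0, -1, 0⟩ : WeierstrassCurve ℤ).baseChange ℚ).IsGloballyMinimal] :
    Ram ((⟨1, 0, 0, -1, 0⟩ : WeierstrassCurve ℤ).baseChange ℚ) 5 :=
  ⟨13, fact_prime_13, by decide, mult_thirteen_65a1,
    by rw [padicValInt_thirteen_minimalDiscriminant_65a1]; decide⟩

/-- **Erratum hypothesis (iv) `E(ℚ₅)[5] = 0` for `65a1`** — a THEOREM here: `5` is a prime of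
NON-SPLIT multiplicative reduction, so `#Ẽ_ns(𝔽₅)·c₅` is prime to `5` and `Ê(5ℤ₅)` has no
`5`-torsion (`LocalTorsion.localTorsion_eq_zero_of_nonsplit`). [cite: SilvermanAEC2009, Thm VII.6.1 and Exercise 3.5]
[cite: Castella2018Erratum, Thm. 1.1 (iv) (p. 1)] -/
theorem localTorsion_five_65a1 [((⟨1, 0, 0, -1, 0⟩ : WeierstrassCurve ℤ).baseChange ℚ).IsElliptic]
    [((⟨1, 0, 0, -1, 0⟩ : WeierstrassCurve ℤ).baseChange ℚ).IsGloballyMinimal] :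
    ∀ P : ((((⟨1, 0, 0, -1, 0⟩ : WeierstrassCurve ℤ).baseChange ℚ)).baseChange ℚ_[5]).toAffine.Point,
      5 • P = 0 → P = 0 :=
  LocalTorsion.localTorsion_eq_zero_of_nonsplit _ 5 (by norm_num) mult_five_65a1 not_split_five_65a1

/-- `#Ẽ(𝔽₂) = 4` for `65a1` (`a₂ = −1`): the reduction `y² + xy = x³ + x` has the three affine points
`(0,0)`, `(1,0)`, `(1,1)` over `𝔽₂`; kernel-decided. [cite: SilvermanAEC2009, V.2] -/
theorem card_F2_65a1 :
    Nat.card (((⟨1, 0, 0, -1, 0⟩ : WeierstrassCurve ℤ).map (Int.castRingHom (ZMod 2))).toAffine.Point) = 4 := by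
  rw [natCard_point_eq_one_add_card _ (by decide)]
  decide

/-- **`E[5]` irreducible for `65a1`**: Frobenius no-root witness at the good prime `ℓ = 2`
(`a₂ = 3 − 4 = −1`, `X² + X + 2` root-free mod `5`; Mazur 1978 Prop. 6.3 (1)).
[cite: Mazur1978, §5 (p. 148) and §6 Prop. 6.3 (1) (p. 153)] -/
theorem irr_five_65a1 [((⟨1, 0, 0, -1, 0⟩ : WeierstrassCurve ℤ).baseChange ℚ).IsElliptic]
    [((⟨1, 0, 0, -1, 0⟩ : WeierstrassCurve ℤ).baseChange ℚ).IsGloballyMinimal] :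
    Irr ((⟨1, 0, 0, -1, 0⟩ : WeierstrassCurve ℤ).baseChange ℚ) 5 :=
  haveI : Fact (Nat.Prime 2) := ⟨by norm_num⟩
  hasIrreducibleModPGaloisRep_of_intModel_of_noroot (integralModelInt_baseChange_int _) 5 2
    (by decide) (by rw [M65a1_Δ]; decide) card_F2_65a1 (by decide)

/-- **`ρ̄_{E,5}` is onto for `65a1`** — a THEOREM (irr(5) ∧ ram(5) ⟹ surj(5): a unipotent inertia
element at `13` + Serre 1972 Prop. 15; `surj_of_irr_of_ram`), so the open input at this pair is NOT
vacuous. [cite: Serre1972, §2.4 Prop. 15] [cite: SilvermanATAEC1994, V.4–V.5 and Exercise 5.13(b)] -/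
theorem surj_five_65a1 [((⟨1, 0, 0, -1, 0⟩ : WeierstrassCurve ℤ).baseChange ℚ).IsElliptic]
    [((⟨1, 0, 0, -1, 0⟩ : WeierstrassCurve ℤ).baseChange ℚ).IsGloballyMinimal] :
    Surj ((⟨1, 0, 0, -1, 0⟩ : WeierstrassCurve ℤ).baseChange ℚ) 5 :=
  surj_of_irr_of_ram _ 5 irr_five_65a1 ram_five_65a1

/-! ## §3 The rung: the open input at `(65a1, 5)` modulo H3♭ at this pair and published facts -/

/-- **BC5 RUNG of crux `OpenInputIMC` (item 19061) at the erratum-claimed (ram) pair `(65a1, 5)`.**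
For `E = 65a1` (`N = 65 = 5·13`, `r_an = 1` by Cremona's table — carried by the `ClassX11b` binder
inside the predicate, not provable in Lean today), `p = 5` (non-split multiplicative, `E[5]`
irreducible, `ρ̄_{E,5}` onto — all kernel theorems above) with the odd NON-split `E[5]`-ramified
multiplicative witness `q = 13` and (iv) `E(ℚ₅)[5] = 0` (kernel theorems above): the PUBLISHED
value-continuity fact (VN_p) `castella2018Exceptional_bdpValueContinuity_trivialChar` + the eleven
published / two cited named facts of the reduction + the JSW control fact + H3♭ AT THIS PAIR
(`P2.IMCDivIntCoreFrameAtErratumData E 5`: erratum (2.4) ⇐ [FW21, Thm. 4.41] on the erratum data of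
`(65a1, 5)`, PREPRINT) ⟹ route p2's open input `P2OpenInputOnTreeAt E 5` at EVERY classical Heegner
datum of the pair. One line from imc-p1 g3's pair-level
`openInputOnTreeAt_of_oddNonsplitRam_of_localTorsion_of_core_of_castella2018Exceptional` (p437572) with
every numerical side condition certified in the kernel. CONDITIONAL on H3♭ at the pair and the named
facts; closes no item; BSD is not proved by any of this. [cite: Castella2018Erratum, Thm. 1.1, (2.4) (pp. 1, 4)]
[cite: Castella2018Exceptional, Thms. 2.10–2.11 (arXiv:1507.04260 pp. 13–14)]
[cite: JetchevSkinnerWan2017, Thm. 3.3.1 with §3.5 (3.5.c) (arXiv:1512.06894 pp. 11, 15)]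
[cite: Wuthrich2014, Prop. 21 (p. 400)] [cite: Cremona1997, Table 1 (curve 65a1)] -/
theorem openInputOnTreeAt_65a1_5
    (hVN : castella2018Exceptional_bdpValueContinuity_trivialChar)
    (hGZ86 : GrossZagier1986_thm_I_7_3) (hGZK : rank_eq_analyticRank_of_analyticRank_le_one)
    (hWu : sha_dvd_analyticSha) (hSk : Skinner2016.thmC_padicValRat_bsd_rank_zero)
    (hnf : exists_isNewformOf) (hCST : CaiShuTian2014.thm11_trivialChar)
    (hFH : friedbergHoffstein_exists_twist_ne_zero_ramifiedAt)
    (hMaz : mazur_not_dvd_maninConstant_of_odd) (h331 : thm331_anticyclotomicControl_mult)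
    (hGZ : ∀ (N : ℕ) [NeZero N] (W : WeierstrassCurve ℚ) (K : Type) [Field K] [NumberField K],
      gross_zagier N W K)
    (hKo : ∀ (N : ℕ) [NeZero N] (W : WeierstrassCurve ℚ) (K : Type) [Field K] [NumberField K],
      kolyvagin N W K)
    (hPT : ∀ (K : Type) [Field K] [NumberField K], poitouTate_sum_localTatePairing_eq_zero K)
    (hEP : ∀ (K : Type) [Field K] [NumberField K] (v : HeightOneSpectrum (𝓞 K)),
      localEulerPoincareCharacteristic (v.adicCompletion K))
    [((⟨1, 0, 0, -1, 0⟩ : WeierstrassCurve ℤ).baseChange ℚ).IsElliptic]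
    [((⟨1, 0, 0, -1, 0⟩ : WeierstrassCurve ℤ).baseChange ℚ).IsGloballyMinimal]
    (h3 : P2.IMCDivIntCoreFrameAtErratumData ((⟨1, 0, 0, -1, 0⟩ : WeierstrassCurve ℤ).baseChange ℚ) 5) :
    P2OpenInputOnTreeAt ((⟨1, 0, 0, -1, 0⟩ : WeierstrassCurve ℤ).baseChange ℚ) 5 :=
  @openInputOnTreeAt_of_oddNonsplitRam_of_localTorsion_of_core_of_castella2018Exceptional _ _ _ 5 _
    hVN hGZ86 hGZK hWu hSk hnf hCST hFH hMaz h331 hGZ hKo hPT hEP h3 13 fact_prime_13 (by decide)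
    (by decide) mult_thirteen_65a1 not_split_thirteen_65a1
    (by rw [padicValInt_thirteen_minimalDiscriminant_65a1]; decide) localTorsion_five_65a1

/-! ## §4 The same rung over the route's ITEMS (by name) and in closed form -/

/-- **The rung over the route's items, by name.** (VN_p) `castella2018Exceptional_bdpValueContinuity_trivialChar`
(PUBLISHED, the by-name leaf `BDPValueContinuityInput` of plan D4) → `IMCDivAtErratumDataAll` (item
19270, H3♭-all — the ONE preprint input; only its instance at `(65a1, 5)` is used) →
`PublishedInputsIMCReduction` (item 19283) → `WuthrichShaDividesAnalyticSha` (item 19285) →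
`thm331_anticyclotomicControl_mult` (JSW17 Thm. 3.3.1-mult, PUBLISHED) ⟹ `P2OpenInputOnTreeAt E 5`
for `E = 65a1`. CONDITIONAL on those items; closes nothing. [cite: Castella2018Erratum, Thm. 1.1, (2.4) (pp. 1, 4)]
[cite: JetchevSkinnerWan2017, Thm. 3.3.1 with §3.5 (3.5.c) (arXiv:1512.06894 pp. 11, 15)]
[cite: Wuthrich2014, Prop. 21 (p. 400)] -/
theorem openInputOnTreeAt_65a1_5_of_items
    (hVN : castella2018Exceptional_bdpValueContinuity_trivialChar)
    (h3 : ErratumRoadFive.IMCDivAtErratumDataAll) (hF : ErratumRoadFive.PublishedInputsIMCReduction)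
    (hWu : ErratumRoadFive.WuthrichShaDividesAnalyticSha) (h331 : thm331_anticyclotomicControl_mult)
    [((⟨1, 0, 0, -1, 0⟩ : WeierstrassCurve ℤ).baseChange ℚ).IsElliptic]
    [((⟨1, 0, 0, -1, 0⟩ : WeierstrassCurve ℤ).baseChange ℚ).IsGloballyMinimal] :
    P2OpenInputOnTreeAt ((⟨1, 0, 0, -1, 0⟩ : WeierstrassCurve ℤ).baseChange ℚ) 5 := by
  unfold ErratumRoadFive.IMCDivAtErratumDataAll at h3
  unfold ErratumRoadFive.WuthrichShaDividesAnalyticSha at hWu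
  obtain ⟨hGZ86, hGZK, hSk, hnf, hCST, hFH, hMaz, hGZ, hKo, -, -, hPTs, -, -, hEP, -⟩ := hF
  exact openInputOnTreeAt_65a1_5 hVN hGZ86 hGZK hWu hSk hnf hCST hFH hMaz h331 hGZ hKo hPTs hEP (h3 _ 5)

/-- **Closed form** — the two instance facts INSTALLED (they are the theorems `isElliptic_65a1`,
`isGloballyMinimal_65a1` of §1), so that the statement displays no instance binder: (VN_p) + the
published ∕ cited facts + JSW control + H3♭ at `(65a1, 5)` ⟹ the open input at `(65a1, 5)`.
CONDITIONAL; closes nothing. [cite: Castella2018Erratum, Thm. 1.1, (2.4) (pp. 1, 4)]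
[cite: Castella2018Exceptional, Thms. 2.10–2.11 (arXiv:1507.04260 pp. 13–14)] -/
theorem openInputOnTreeAt_65a1_5_closed
    (hVN : castella2018Exceptional_bdpValueContinuity_trivialChar)
    (hGZ86 : GrossZagier1986_thm_I_7_3) (hGZK : rank_eq_analyticRank_of_analyticRank_le_one)
    (hWu : sha_dvd_analyticSha) (hSk : Skinner2016.thmC_padicValRat_bsd_rank_zero)
    (hnf : exists_isNewformOf) (hCST : CaiShuTian2014.thm11_trivialChar)
    (hFH : friedbergHoffstein_exists_twist_ne_zero_ramifiedAt)
    (hMaz : mazur_not_dvd_maninConstant_of_odd) (h331 : thm331_anticyclotomicControl_mult)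
    (hGZ : ∀ (N : ℕ) [NeZero N] (W : WeierstrassCurve ℚ) (K : Type) [Field K] [NumberField K],
      gross_zagier N W K)
    (hKo : ∀ (N : ℕ) [NeZero N] (W : WeierstrassCurve ℚ) (K : Type) [Field K] [NumberField K],
      kolyvagin N W K)
    (hPT : ∀ (K : Type) [Field K] [NumberField K], poitouTate_sum_localTatePairing_eq_zero K)
    (hEP : ∀ (K : Type) [Field K] [NumberField K] (v : HeightOneSpectrum (𝓞 K)),
      localEulerPoincareCharacteristic (v.adicCompletion K))
    (h3 : @P2.IMCDivIntCoreFrameAtErratumData ((⟨1, 0, 0, -1, 0⟩ : WeierstrassCurve ℤ).baseChange ℚ)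
      isGloballyMinimal_65a1 5 _) :
    @P2OpenInputOnTreeAt ((⟨1, 0, 0, -1, 0⟩ : WeierstrassCurve ℤ).baseChange ℚ)
      isElliptic_65a1 isGloballyMinimal_65a1 5 _ :=
  haveI := isElliptic_65a1
  haveI := isGloballyMinimal_65a1
  openInputOnTreeAt_65a1_5 hVN hGZ86 hGZK hWu hSk hnf hCST hFH hMaz h331 hGZ hKo hPT hEP h3

/-! ## §5 (append, same session) The printed-regime check: at `(65a1, 5)` the open input ALSO follows
from PRINT ALONE — Miller 2011 Thm. 1.2 (`N = 65 < 5000`) + one-sided tightness — so this rung sits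
INSIDE S's printed per-curve regime; its companion OUTSIDE that regime is
`ErratumRoadFiveOpenInputRung5835a1.lean` (`N = 5835 ≥ 5000`). -/

/-- **`(65a1, 5)` is inside the printed per-curve regime.** `N(65a1) = 65 < 5000` (kernel numeral),
`E[5]` irreducible (kernel), so the PUBLISHED per-curve theorem Miller 2011 Thm. 1.2
(`bsdp_of_irreducible_of_conductor_lt`; `r_an ≤ 1` from the `ClassX11b` binder inside the predicate)
gives `BSD(65a1, 5)`, and multr1-p2's tightness `P2.openInputOnTreeAt_of_bsdp_of_ram` (Gross–Zagier,
Kolyvagin, Skinner 2016 Thm. C for the classical twist, GZK, modularity, the JSW control identity; (ram)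
via `q = 13`) returns the open input `P2OpenInputOnTreeAt E 5` — WITHOUT H3♭. Filed so that the record
shows honestly which of the two rungs is a witness outside print (BC5 doctrine,
`plan/D0059/BC5-CORRECTION-K2a-g23.md`): this one is not; `openInputOnTreeAt_5835a1_5` is. CONDITIONAL on
the named published facts; closes nothing. [cite: Miller2011LMS, Thm. 1.2 (arXiv:1010.2431)]
[cite: LawsonWuthrich2016, §5, Thm. 14 and Prop. 15] [cite: JetchevSkinnerWan2017, Thm. 3.3.1, §7.4.1]
[cite: Skinner2016PacificMC, Thm. C (§1)] -/
theorem openInputOnTreeAt_65a1_5_of_miller (hMiller : bsdp_of_irreducible_of_conductor_lt)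
    (hGZ : ∀ (N : ℕ) [NeZero N] (W : WeierstrassCurve ℚ) (K : Type) [Field K] [NumberField K],
      gross_zagier N W K)
    (hKo : ∀ (N : ℕ) [NeZero N] (W : WeierstrassCurve ℚ) (K : Type) [Field K] [NumberField K],
      kolyvagin N W K)
    (hSk : Skinner2016.thmC_padicValRat_bsd_rank_zero) (hGZK : rank_eq_analyticRank_of_analyticRank_le_one)
    (hnf : exists_isNewformOf) (h331 : thm331_anticyclotomicControl_mult)
    [((⟨1, 0, 0, -1, 0⟩ : WeierstrassCurve ℤ).baseChange ℚ).IsElliptic]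
    [((⟨1, 0, 0, -1, 0⟩ : WeierstrassCurve ℤ).baseChange ℚ).IsGloballyMinimal] :
    P2OpenInputOnTreeAt ((⟨1, 0, 0, -1, 0⟩ : WeierstrassCurve ℤ).baseChange ℚ) 5 := by
  refine p2OpenInputOnTreeAt_of_imp_surj _ 5 fun hX _ _ ↦ ?_
  have hbsd : BSDp ((⟨1, 0, 0, -1, 0⟩ : WeierstrassCurve ℤ).baseChange ℚ) 5 :=
    hMiller _ (le_of_eq hX.1) (by rw [conductorNorm_65a1]; norm_num) 5 (by norm_num) irr_five_65a1
  exact P2.openInputOnTreeAt_of_bsdp_of_ram _ 5 hGZ hKo hSk hGZK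
    (hasEntireLFunction_rat_of_exists_isNewformOf hnf) (p2ControlOnTreeAt_of_thm331Mult _ 5 h331 hKo)
    ram_five_65a1 hbsd

end Summit.BirchSwinnertonDyer.BirchSwinnertonDyer.Theorems

end
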